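import Literature.NumberTheory.LFunctions.SoundZeroSideSums
import Mathlib.Analysis.PSeries
import HarnessLib

/-!
# Soundararajan's main lemma (Balazard–de Roton 2008, Prop. 5) via the Weil explicit formula

Topic `Literature/NumberTheory/LFunctions`. Everything here is PROVED. We assemble
M. Balazard, A. de Roton, *Notes de lecture de l'article "Partial sums of the Möbius function"
de Kannan Soundararajan*, arXiv:0810.3587, **Proposition 5** (under RH): for `t` large,
`½ < σ ≤ 2` and `3 ≤ x ≤ t`,

  `log|ζ(σ+it)| ≥ Re Σ_{n≤x} Λ(n) log(x/n)/(n^{σ+it} log n log x)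
                  − (1 + x^{½−σ}/((σ−½) log x)) F(σ+it)/log x − C`,

`F(s) = Σ_ρ m(ρ) Re 1/(s−ρ)` (`reZeroSideSum`). Instead of BR's Prop. 3/(t55) (Perron's formula and
the partial-fraction expansion of `ζ'/ζ`) we use the Guinand–Weil explicit formula of the tree
(`explicit_formula_continuous`) for the test functions `g_u = SoundTest.test ((u−½)+it) (log x)`,
`u ∈ [σ, 2]`, whose prime side is `2 Σ_{n≤x} Λ(n) n^{−u−it} log(x/n)` (the left side of (t55)),
integrate the real part over `u ∈ [σ, 2]` exactly as BR do, and identify: the zero side gives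
`F(σ+it)`, `F(2+it)`, the `x^{ρ−z}` terms and `2 log x ∫_σ^2 F(u+it) du`
(`SoundZeroTermIntegrals`, `SoundZeroSideSums`), the latter being
`log|ζ(2+it)| − log|ζ(σ+it)| + (2−σ)(log t)/2 + O(1)` by BR Prop. 2
(`abs_re_logDeriv_zeta_sub_reZeroSideSum_le`) and `d/du log|ζ(u+it)| = Re ζ'/ζ`; the archimedean
side is `(2−σ) log x log t + O(log x)` (`re_weilArchTerm_test`), which cancels the `log t` term.

* `SoundTest.BR_prop5` — the statement above (real-part form of the Dirichlet polynomial: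
  `Re Λ(n) log(x/n)/(n^{σ+it} log n) = Λ(n)(log x − log n) cos(t log n) n^{−σ}/log n`).

## References

* [BalazardDeRoton2008] M. Balazard, A. de Roton, arXiv:0810.3587, Prop. 5. [cite: BalazardDeRoton2008, Prop. 5]
* K. Soundararajan, *Partial sums of the Möbius function*, J. reine angew. Math. 631 (2009), 141–152, Lemma 1 /
  main Proposition (the `log|ζ|` lower bound; its zeta-moments twin is Soundararajan, Ann. of Math. 170 (2009)).
-/

noncomputable section

open Complex Filter Set MeasureTheory Topology intervalIntegral
open scoped Real ComplexConjugate

namespace Literature.NumberTheory.LFunctions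

namespace SoundTest

/-- Short name for the subtype of non-trivial zeros. -/
local notation "𝒵" => ZetaZeros.riemannZetaNontrivialZeros

/-! ## The `ζ` side: `∫_σ^2 F(u+it) du` versus `log|ζ|` -/

/-- Under RH, `ζ(u + it) ≠ 0` for `u > ½`, `t ≠ 0`. [folklore] -/
theorem zeta_line_ne_zero (hRH : RiemannHypothesis) {u t : ℝ} (hu : 1 / 2 < u) (ht : t ≠ 0) :
    riemannZeta ((u : ℂ) + t * I) ≠ 0 := by
  intro h0
  have h1 : ((u : ℂ) + t * I) ≠ 1 := fun h ↦ by
    have := congrArg Complex.im h; simp at this; exact ht this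
  have htriv : ¬∃ n : ℕ, ((u : ℂ) + t * I) = -2 * (n + 1) := by
    rintro ⟨n, hn⟩
    have := congrArg Complex.im hn; simp at this; exact ht this
  have := hRH _ h0 htriv h1
  simp at this
  linarith

/-- `ζ` is analytic at `u + it`, `t ≠ 0`. [folklore] -/
theorem analyticAt_zeta_line {u t : ℝ} (ht : t ≠ 0) : AnalyticAt ℂ riemannZeta ((u : ℂ) + t * I) := by
  have hw : ((u : ℂ) + t * I) ≠ 1 := fun h ↦ by
    have := congrArg Complex.im h; simp at this; exact ht this
  exact Complex.analyticAt_iff_eventually_differentiableAt.2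
    ((isOpen_ne.eventually_mem hw).mono fun _ hz ↦ differentiableAt_riemannZeta hz)

/-- **`∫_σ^2 Re ζ'/ζ(u+it) du = log|ζ(2+it)| − log|ζ(σ+it)|`** (RH, `½ < σ ≤ 2`, `t ≠ 0`). [folklore] -/
theorem integral_re_logDeriv_zeta (hRH : RiemannHypothesis) {σ t : ℝ} (hσ : 1 / 2 < σ) (hσ2 : σ ≤ 2) (ht : t ≠ 0) :
    ∫ u in σ..2, (deriv riemannZeta ((u : ℂ) + t * I) / riemannZeta ((u : ℂ) + t * I)).re =
      Real.log ‖riemannZeta ((2 : ℂ) + t * I)‖ - Real.log ‖riemannZeta ((σ : ℂ) + t * I)‖ := by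
  have hg : ∀ u ∈ Icc σ 2, AnalyticAt ℂ riemannZeta ((u : ℂ) + t * I) := fun u _ ↦ analyticAt_zeta_line ht
  have h0 : ∀ u ∈ Icc σ 2, riemannZeta ((u : ℂ) + t * I) ≠ 0 := fun u hu ↦
    zeta_line_ne_zero hRH (by linarith [hu.1]) ht
  have h := Literature.Analysis.Complex.re_integral_logDeriv_horizontal t hσ2 hg h0
  have hint : IntervalIntegrable (fun u : ℝ ↦ deriv riemannZeta ((u : ℂ) + t * I) / riemannZeta ((u : ℂ) + t * I))
      volume σ 2 := by
    refine ContinuousOn.intervalIntegrable_of_Icc hσ2 fun u hu ↦ ?_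
    exact ((Literature.Analysis.Complex.continuousAt_logDeriv (hg u hu) (h0 u hu)).comp
      (f := fun u : ℝ ↦ (u : ℂ) + t * I) (by fun_prop)).continuousWithinAt
  have hre := intervalIntegral_re hint
  simp only [RCLike.re_to_complex] at hre
  rw [hre, h]
  push_cast
  ring

/-- **BR Prop. 2 integrated over `u ∈ [σ, 2]`** (RH, `½ < σ ≤ 2`, `t ≥ 2`):
`|∫_σ^2 F(u+it) du − (log|ζ(2+it)| − log|ζ(σ+it)|) − (2−σ)(log t)/2| ≤ 4(2−σ)`. [cite: BalazardDeRoton2008, Prop. 2] -/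
theorem abs_integral_reZeroSideSum_sub_le (hRH : RiemannHypothesis) {σ t : ℝ} (hσ : 1 / 2 < σ) (hσ2 : σ ≤ 2)
    (ht : 2 ≤ t) :
    |(∫ u in σ..2, reZeroSideSum ((u : ℂ) + t * I)) -
        (Real.log ‖riemannZeta ((2 : ℂ) + t * I)‖ - Real.log ‖riemannZeta ((σ : ℂ) + t * I)‖) -
          (2 - σ) * (Real.log t / 2)| ≤ 4 * (2 - σ) := by
  have ht0 : t ≠ 0 := by intro h; rw [h] at ht; linarith
  set D : ℝ → ℝ := fun u ↦ (deriv riemannZeta ((u : ℂ) + t * I) / riemannZeta ((u : ℂ) + t * I)).re -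
    (reZeroSideSum ((u : ℂ) + t * I) - Real.log t / 2) with hD
  have hDle : ∀ u ∈ Set.Ioc σ 2, ‖D u‖ ≤ 4 := by
    intro u hu
    rw [Real.norm_eq_abs, hD]
    have := abs_re_logDeriv_zeta_sub_reZeroSideSum_le (s := (u : ℂ) + t * I) (by simp; linarith [hu.1])
      (by simp; linarith [hu.2]) (by simpa using ht) (zeta_line_ne_zero hRH (by linarith [hu.1]) ht0)
    simpa using this
  have hg : ∀ u ∈ Icc σ 2, AnalyticAt ℂ riemannZeta ((u : ℂ) + t * I) := fun u _ ↦ analyticAt_zeta_line ht0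
  have h0 : ∀ u ∈ Icc σ 2, riemannZeta ((u : ℂ) + t * I) ≠ 0 := fun u hu ↦
    zeta_line_ne_zero hRH (by linarith [hu.1]) ht0
  have hi1 : IntervalIntegrable (fun u : ℝ ↦ (deriv riemannZeta ((u : ℂ) + t * I) / riemannZeta ((u : ℂ) + t * I)).re)
      volume σ 2 := by
    refine ContinuousOn.intervalIntegrable_of_Icc hσ2 fun u hu ↦ ?_
    exact (Complex.continuous_re.continuousAt.comp ((Literature.Analysis.Complex.continuousAt_logDeriv (hg u hu)
      (h0 u hu)).comp (f := fun u : ℝ ↦ (u : ℂ) + t * I) (by fun_prop))).continuousWithinAt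
  have hi2 : IntervalIntegrable (fun u : ℝ ↦ reZeroSideSum ((u : ℂ) + t * I)) volume σ 2 :=
    (continuousOn_reZeroSideSum hRH hσ t).intervalIntegrable_of_Icc hσ2
  have hi3 : IntervalIntegrable (fun _ : ℝ ↦ Real.log t / 2) volume σ 2 := intervalIntegrable_const
  have hDint : ∫ u in σ..2, D u = (Real.log ‖riemannZeta ((2 : ℂ) + t * I)‖ - Real.log ‖riemannZeta ((σ : ℂ) + t * I)‖) -
      ((∫ u in σ..2, reZeroSideSum ((u : ℂ) + t * I)) - (2 - σ) * (Real.log t / 2)) := by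
    simp only [hD]
    rw [intervalIntegral.integral_sub hi1 (hi2.sub hi3), intervalIntegral.integral_sub hi2 hi3,
      integral_re_logDeriv_zeta hRH hσ hσ2 ht0, intervalIntegral.integral_const, smul_eq_mul]
  have hbound := intervalIntegral.norm_integral_le_of_norm_le_const (a := σ) (b := 2) (C := 4) (f := D)
    (by rwa [Set.uIoc_of_le hσ2])
  rw [Real.norm_eq_abs, hDint, abs_of_nonneg (by linarith : (0 : ℝ) ≤ 2 - σ)] at hbound
  rw [abs_sub_comm] at hbound
  set A : ℝ := ∫ u in σ..2, reZeroSideSum ((u : ℂ) + t * I) with hA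
  have e : A - (Real.log ‖riemannZeta ((2 : ℂ) + t * I)‖ - Real.log ‖riemannZeta ((σ : ℂ) + t * I)‖) -
      (2 - σ) * (Real.log t / 2) =
      A - (2 - σ) * (Real.log t / 2) -
        (Real.log ‖riemannZeta ((2 : ℂ) + t * I)‖ - Real.log ‖riemannZeta ((σ : ℂ) + t * I)‖) := by ring
  rw [e]
  exact hbound

/-! ## The prime side -/

/-- The Dirichlet polynomial of BR Prop. 5 in real form:
`Q_{x,t}(σ') = Σ_{n≤x} Λ(n)(log x − log n) cos(t log n) e^{−σ' log n}/log n`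
( `= Re Σ_{n≤x} Λ(n) log(x/n)/(n^{σ'+it} log n)` ). [cite: BalazardDeRoton2008, Prop. 5] -/
def primeQ (x t σ' : ℝ) : ℝ :=
  ∑ n ∈ Finset.Icc 1 ⌊x⌋₊, (ArithmeticFunction.vonMangoldt n : ℝ) * (Real.log x - Real.log n) *
    Real.cos (t * Real.log n) * Real.exp (-σ' * Real.log n) / Real.log n

/-- The real part of the prime side of the explicit formula for `g_u`:
`Re P(g_u) = 2 Σ_{n≤x} Λ(n)(log x − log n) cos(t log n) e^{−u log n}` (`x ≥ 1`). [folklore] -/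
theorem re_weilPrimeTerm_test {x : ℝ} (hx : 1 ≤ x) (t u : ℝ) :
    (weilPrimeTerm (test (((u - 1 / 2 : ℝ) : ℂ) + t * I) (Real.log x))).re =
      2 * ∑ n ∈ Finset.Icc 1 ⌊x⌋₊, (ArithmeticFunction.vonMangoldt n : ℝ) * (Real.log x - Real.log n) *
        Real.cos (t * Real.log n) * Real.exp (-u * Real.log n) := by
  rw [weilPrimeTerm_test, Real.exp_log (by linarith), show (2 : ℂ) = ((2 : ℝ) : ℂ) by norm_num,
    Complex.re_ofReal_mul, Complex.re_sum]
  congr 1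
  refine Finset.sum_congr rfl fun n hn ↦ ?_
  rw [Finset.mem_Icc] at hn
  have hn0 : (0 : ℝ) < n := by exact_mod_cast hn.1
  have hsqrt : (Real.sqrt n : ℂ) = Complex.exp (((Real.log n / 2 : ℝ) : ℂ)) := by
    rw [← Complex.ofReal_exp]
    congr 1
    rw [Real.sqrt_eq_rpow, Real.rpow_def_of_pos hn0]
    congr 1; ring
  have hpq : -(((Real.log n / 2 : ℝ)) : ℂ) + -((((u - 1 / 2 : ℝ) : ℂ) + t * I) * Real.log n) =
      ((-u * Real.log n : ℝ) : ℂ) + ((-(t * Real.log n) : ℝ) : ℂ) * I := by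
    push_cast; ring
  have e : ((ArithmeticFunction.vonMangoldt n : ℝ) : ℂ) / (Real.sqrt n : ℂ) *
      (Complex.exp (-((((u - 1 / 2 : ℝ) : ℂ) + t * I) * Real.log n)) * ((Real.log x - Real.log n : ℝ) : ℂ)) =
      ((ArithmeticFunction.vonMangoldt n * (Real.log x - Real.log n) : ℝ) : ℂ) *
        Complex.exp (((-u * Real.log n : ℝ) : ℂ) + ((-(t * Real.log n) : ℝ) : ℂ) * I) := by
    rw [hsqrt, div_eq_mul_inv, ← Complex.exp_neg]
    calc ((ArithmeticFunction.vonMangoldt n : ℝ) : ℂ) * Complex.exp (-(((Real.log n / 2 : ℝ)) : ℂ)) *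
          (Complex.exp (-((((u - 1 / 2 : ℝ) : ℂ) + t * I) * Real.log n)) * ((Real.log x - Real.log n : ℝ) : ℂ))
        = ((ArithmeticFunction.vonMangoldt n : ℝ) : ℂ) * ((Real.log x - Real.log n : ℝ) : ℂ) *
            (Complex.exp (-(((Real.log n / 2 : ℝ)) : ℂ)) * Complex.exp (-((((u - 1 / 2 : ℝ) : ℂ) + t * I) * Real.log n))) := by
          ring
      _ = ((ArithmeticFunction.vonMangoldt n : ℝ) : ℂ) * ((Real.log x - Real.log n : ℝ) : ℂ) *
            Complex.exp (((-u * Real.log n : ℝ) : ℂ) + ((-(t * Real.log n) : ℝ) : ℂ) * I) := by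
          rw [← Complex.exp_add, hpq]
      _ = _ := by push_cast; ring
  rw [e, Complex.re_ofReal_mul, Complex.exp_re, Complex.add_re, Complex.ofReal_re, Complex.mul_re,
    Complex.ofReal_re, Complex.ofReal_im, Complex.I_re, Complex.I_im, Complex.add_im, Complex.ofReal_im,
    Complex.mul_im, Complex.ofReal_re, Complex.ofReal_im, Complex.I_re, Complex.I_im]
  simp only [mul_zero, sub_zero, zero_add, mul_one, add_zero, Real.cos_neg]
  ring

/-- `∫_σ^2 e^{−u log n} du` against `Λ(n)`: `Λ(n) ∫_σ^2 e^{−u log n} du = Λ(n)(e^{−σ log n} − e^{−2 log n})/log n`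
(both sides vanish for `n = 1`). [folklore] -/
theorem vonMangoldt_mul_integral_exp (n : ℕ) (σ : ℝ) :
    (ArithmeticFunction.vonMangoldt n : ℝ) * ∫ u in σ..2, Real.exp (-u * Real.log n) =
      (ArithmeticFunction.vonMangoldt n : ℝ) * ((Real.exp (-σ * Real.log n) - Real.exp (-2 * Real.log n)) / Real.log n) := by
  rcases Nat.lt_or_ge n 2 with hn | hn
  · interval_cases n <;> simp
  · have hlog : 0 < Real.log n := Real.log_pos (by exact_mod_cast hn)
    congr 1
    have hderiv : ∀ u ∈ Set.uIcc σ 2, HasDerivAt (fun u : ℝ ↦ -Real.exp (-u * Real.log n) / Real.log n)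
        (Real.exp (-u * Real.log n)) u := by
      intro u _
      have h1 : HasDerivAt (fun u : ℝ ↦ -u * Real.log n) (-Real.log n) u := by
        simpa using ((hasDerivAt_id u).neg).mul_const (Real.log n)
      refine ((h1.exp).neg.div_const (Real.log n)).congr_deriv ?_
      field_simp
    rw [intervalIntegral.integral_eq_sub_of_hasDerivAt hderiv ((Continuous.intervalIntegrable (by fun_prop) _ _))]
    field_simp
    ring

/-- **The prime side integrated**: `∫_σ^2 Re P(g_u) du = 2 (Q(σ) − Q(2))` (`x ≥ 1`). [cite: BalazardDeRoton2008, Prop. 5 (proof)] -/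
theorem integral_re_weilPrimeTerm_test {x : ℝ} (hx : 1 ≤ x) (t σ : ℝ) :
    ∫ u in σ..2, (weilPrimeTerm (test (((u - 1 / 2 : ℝ) : ℂ) + t * I) (Real.log x))).re =
      2 * (primeQ x t σ - primeQ x t 2) := by
  simp_rw [re_weilPrimeTerm_test hx]
  rw [intervalIntegral.integral_const_mul, intervalIntegral.integral_finsetSum (fun n _ ↦
    (Continuous.intervalIntegrable (by fun_prop) _ _))]
  unfold primeQ
  rw [← Finset.sum_sub_distrib]
  congr 1
  refine Finset.sum_congr rfl fun n _ ↦ ?_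
  rw [intervalIntegral.integral_const_mul]
  have h := vonMangoldt_mul_integral_exp n σ
  calc (ArithmeticFunction.vonMangoldt n : ℝ) * (Real.log x - Real.log n) * Real.cos (t * Real.log n) *
        ∫ u in σ..2, Real.exp (-u * Real.log n)
      = (Real.log x - Real.log n) * Real.cos (t * Real.log n) *
          ((ArithmeticFunction.vonMangoldt n : ℝ) * ∫ u in σ..2, Real.exp (-u * Real.log n)) := by ring
    _ = (Real.log x - Real.log n) * Real.cos (t * Real.log n) *
          ((ArithmeticFunction.vonMangoldt n : ℝ) *
            ((Real.exp (-σ * Real.log n) - Real.exp (-2 * Real.log n)) / Real.log n)) := by rw [h]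
    _ = _ := by ring

/-- `|Q(2)| ≤ 2 log x` (`x ≥ 1`; `Λ(n) ≤ log n` and `Σ 1/n² ≤ 2`). [folklore] -/
theorem abs_primeQ_two_le {x : ℝ} (hx : 1 ≤ x) (t : ℝ) : |primeQ x t 2| ≤ 2 * Real.log x := by
  unfold primeQ
  have hL : 0 ≤ Real.log x := Real.log_nonneg hx
  refine (Finset.abs_sum_le_sum_abs _ _).trans ?_
  have hterm : ∀ n ∈ Finset.Icc 1 ⌊x⌋₊, |(ArithmeticFunction.vonMangoldt n : ℝ) * (Real.log x - Real.log n) *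
      Real.cos (t * Real.log n) * Real.exp (-2 * Real.log n) / Real.log n| ≤ Real.log x * ((n : ℝ) ^ 2)⁻¹ := by
    intro n hn
    rw [Finset.mem_Icc] at hn
    have hn0 : (0 : ℝ) < n := by exact_mod_cast hn.1
    rcases eq_or_lt_of_le hn.1 with h1 | h1
    · subst h1; simp; positivity
    · have hlogn : 0 < Real.log n := Real.log_pos (by exact_mod_cast h1)
      have hΛ : (ArithmeticFunction.vonMangoldt n : ℝ) ≤ Real.log n := ArithmeticFunction.vonMangoldt_le_log
      have hΛ0 : (0 : ℝ) ≤ ArithmeticFunction.vonMangoldt n := ArithmeticFunction.vonMangoldt_nonneg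
      have hexp : Real.exp (-2 * Real.log n) = ((n : ℝ) ^ 2)⁻¹ := by
        rw [show -2 * Real.log n = -(Real.log ((n : ℝ) ^ 2)) by rw [Real.log_pow]; push_cast; ring,
          Real.exp_neg, Real.exp_log (by positivity)]
      have hlx : |Real.log x - Real.log n| ≤ Real.log x := by
        have hnx : Real.log n ≤ Real.log x := by
          refine Real.log_le_log hn0 ?_
          exact (Nat.cast_le.2 hn.2).trans (Nat.floor_le (by linarith))
        rw [abs_le]; constructor <;> linarith [hlogn]
      rw [abs_div, abs_mul, abs_mul, abs_mul, abs_of_nonneg hΛ0, abs_of_pos hlogn, hexp,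
        abs_of_pos (by positivity : (0 : ℝ) < ((n : ℝ) ^ 2)⁻¹)]
      have hcos : |Real.cos (t * Real.log n)| ≤ 1 := Real.abs_cos_le_one _
      rw [div_le_iff₀ hlogn]
      have h2 : (ArithmeticFunction.vonMangoldt n : ℝ) * |Real.log x - Real.log n| ≤ Real.log n * Real.log x :=
        mul_le_mul hΛ hlx (abs_nonneg _) hlogn.le
      calc (ArithmeticFunction.vonMangoldt n : ℝ) * |Real.log x - Real.log n| * |Real.cos (t * Real.log n)| * ((n : ℝ) ^ 2)⁻¹
          ≤ Real.log n * Real.log x * 1 * ((n : ℝ) ^ 2)⁻¹ := by gcongr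
        _ = Real.log x * ((n : ℝ) ^ 2)⁻¹ * Real.log n := by ring
  refine (Finset.sum_le_sum hterm).trans ?_
  rw [← Finset.mul_sum]
  have hsum : ∑ n ∈ Finset.Icc 1 ⌊x⌋₊, ((n : ℝ) ^ 2)⁻¹ ≤ 2 := by
    have h := sum_Ioo_inv_sq_le (α := ℝ) 0 (⌊x⌋₊ + 1)
    have e : Finset.Ioo 0 (⌊x⌋₊ + 1) = Finset.Icc 1 ⌊x⌋₊ := by
      ext n; simp [Finset.mem_Ioo, Finset.mem_Icc]; omega
    rw [e] at h
    norm_num at h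
    exact_mod_cast h
  calc Real.log x * ∑ n ∈ Finset.Icc 1 ⌊x⌋₊, ((n : ℝ) ^ 2)⁻¹ ≤ Real.log x * 2 := by gcongr
    _ = 2 * Real.log x := by ring

/-! ## The polar term -/

/-- `‖Ψ_L(a)‖ ≤ (e^{(Re a) L} + 1 + ‖a‖L)/‖a‖²` for `a ≠ 0`, `L ≥ 0` (no sign condition). [folklore] -/
theorem norm_psiInt_le_general {L : ℝ} (hL : 0 ≤ L) {a : ℂ} (ha : a ≠ 0) :
    ‖psiInt L a‖ ≤ (Real.exp (a.re * L) + 1 + ‖a‖ * L) / ‖a‖ ^ 2 := by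
  rw [psiInt_eq ha, norm_div, norm_pow]
  refine div_le_div_of_nonneg_right ?_ (by positivity)
  have h1 : ‖Complex.exp (a * L)‖ = Real.exp (a.re * L) := by
    rw [Complex.norm_exp]; congr 1; simp
  calc ‖Complex.exp (a * L) - 1 - a * L‖ ≤ ‖Complex.exp (a * L)‖ + ‖(1 : ℂ)‖ + ‖a * L‖ := by
        have := norm_sub_le (Complex.exp (a * L) - 1) (a * L)
        have := norm_sub_le (Complex.exp (a * L)) 1
        linarith
    _ = Real.exp (a.re * L) + 1 + ‖a‖ * L := by
        rw [h1, norm_one, norm_mul, Complex.norm_real, Real.norm_eq_abs, abs_of_nonneg hL]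

/-- The polar term of `g_u`: `ĝ_u(0) + ĝ_u(1) = 2 (Ψ(−z_u) + Ψ(1 − z_u))`. [folklore] -/
theorem weilPolarTerm_test_eq {L : ℝ} (hL : 0 ≤ L) (u t : ℝ) :
    weilPolarTerm (test (((u - 1 / 2 : ℝ) : ℂ) + t * I) L) =
      2 * (psiInt L (-((u : ℂ) + t * I)) + psiInt L (1 - ((u : ℂ) + t * I))) := by
  unfold weilPolarTerm
  rw [weilMellin_test_zero_eq hL u t 0, weilMellin_test_zero_eq hL u t 1]
  ring_nf

/-- **Bound for the polar term**: `‖ĝ_u(0) + ĝ_u(1)‖ ≤ 8` for `u ∈ [½, 2]`, `8 ≤ t`, `0 ≤ L ≤ t`,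
`e^L ≤ t`. [folklore] -/
theorem norm_weilPolarTerm_test_le {L u t : ℝ} (hL : 0 ≤ L) (hLt : L ≤ t) (hxt : Real.exp L ≤ t) (ht : 8 ≤ t)
    (hu1 : 1 / 2 ≤ u) :
    ‖weilPolarTerm (test (((u - 1 / 2 : ℝ) : ℂ) + t * I) L)‖ ≤ 8 := by
  rw [weilPolarTerm_test_eq hL, norm_mul, Complex.norm_ofNat]
  have ht0 : 0 < t := by linarith
  -- both points have `|Im| = t`, hence norm `≥ t`
  have key : ∀ w : ℝ, w ≤ 1 → ‖psiInt L ((w : ℂ) - ((u : ℂ) + t * I))‖ ≤ 2 := by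
    intro w hw
    set a : ℂ := (w : ℂ) - ((u : ℂ) + t * I) with ha
    have haim : a.im = -t := by simp [ha]
    have hare : a.re = w - u := by simp [ha]
    have hna : t ≤ ‖a‖ := by
      have := Complex.abs_im_le_norm a; rwa [haim, abs_neg, abs_of_pos ht0] at this
    have ha0 : a ≠ 0 := fun h ↦ by rw [h, norm_zero] at hna; linarith
    refine (norm_psiInt_le_general hL ha0).trans ?_
    rw [div_le_iff₀ (by positivity), hare]
    have hexp : Real.exp ((w - u) * L) ≤ t := by
      refine le_trans (Real.exp_le_exp.2 ?_) hxt
      nlinarith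
    have h2 : t ^ 2 ≤ ‖a‖ ^ 2 := pow_le_pow_left₀ ht0.le hna 2
    nlinarith [norm_nonneg a]
  have h0 := key 0 (by norm_num)
  have h1 := key 1 le_rfl
  push_cast at h0 h1
  rw [zero_sub] at h0
  calc 2 * ‖psiInt L (-((u : ℂ) + t * I)) + psiInt L (1 - ((u : ℂ) + t * I))‖
      ≤ 2 * (‖psiInt L (-((u : ℂ) + t * I))‖ + ‖psiInt L (1 - ((u : ℂ) + t * I))‖) := by
        gcongr; exact norm_add_le _ _
    _ ≤ 2 * (2 + 2) := by gcongr
    _ = 8 := by norm_num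

/-- `u ↦ Ψ_L(w − (u+it))` is continuous on `[σ,2]` whenever `w − (u+it) ≠ 0` there. [folklore] -/
theorem continuousOn_psiInt_sub_line' {w : ℂ} {σ : ℝ} (t L : ℝ)
    (hne : ∀ u ∈ Icc σ 2, w - ((u : ℂ) + t * I) ≠ 0) :
    ContinuousOn (fun u : ℝ ↦ psiInt L (w - ((u : ℂ) + t * I))) (Icc σ 2) := by
  have hc : ContinuousOn (fun u : ℝ ↦ (Complex.exp ((w - ((u : ℂ) + t * I)) * L) - 1 - (w - ((u : ℂ) + t * I)) * L) /
      (w - ((u : ℂ) + t * I)) ^ 2) (Icc σ 2) :=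
    ContinuousOn.div (by fun_prop) (by fun_prop) fun u hu ↦ pow_ne_zero 2 (hne u hu)
  exact hc.congr fun u hu ↦ psiInt_eq (hne u hu)

/-- The polar term is continuous in `u` on `[σ, 2]` (`t ≠ 0`). [folklore] -/
theorem continuousOn_weilPolarTerm_test {σ t L : ℝ} (hL : 0 ≤ L) (ht : t ≠ 0) :
    ContinuousOn (fun u : ℝ ↦ weilPolarTerm (test (((u - 1 / 2 : ℝ) : ℂ) + t * I) L)) (Icc σ 2) := by
  have hne : ∀ (w : ℝ), ∀ u ∈ Icc σ 2, (w : ℂ) - ((u : ℂ) + t * I) ≠ 0 := by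
    intro w u _ h
    have := congrArg Complex.im h; simp at this; exact ht this
  have h0 := continuousOn_psiInt_sub_line' (w := ((0 : ℝ) : ℂ)) t L (hne 0)
  have h1 := continuousOn_psiInt_sub_line' (w := ((1 : ℝ) : ℂ)) t L (hne 1)
  push_cast at h0 h1
  simp only [zero_sub] at h0
  refine ((continuousOn_const (c := (2 : ℂ))).mul (h0.add h1)).congr fun u _ ↦ ?_
  rw [weilPolarTerm_test_eq hL]
  rfl

/-! ## Auxiliary facts on the zero side under RH -/

/-- Under RH: `‖(σ+it) − ρ̄‖² = (σ−½)² + (γ+t)²`. [folklore] -/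
theorem norm_sq_sub_conj_zero_of_RH (hRH : RiemannHypothesis) (ρ : 𝒵) (σ t : ℝ) :
    ‖((σ : ℂ) + t * I) - conj (ρ : ℂ)‖ ^ 2 = (σ - 1 / 2) ^ 2 + ((ρ : ℂ).im + t) ^ 2 := by
  rw [Complex.sq_norm, Complex.normSq_apply]
  simp [re_eq_half_of_RH hRH ρ]
  ring

/-- Summability of `m(ρ) Re 1/((σ+it) − ρ)` under RH (`σ > ½`); its sum is `F(σ+it)`. [folklore] -/
theorem summable_zeroOrder_mul_re_inv (hRH : RiemannHypothesis) {σ : ℝ} (hσ : 1 / 2 < σ) (t : ℝ) :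
    Summable fun ρ : 𝒵 ↦ (riemannZetaZeroOrder (ρ : ℂ) : ℝ) * (1 / (((σ : ℂ) + t * I) - ρ)).re := by
  have h := (summable_zeroOrder_div_dist_sq hσ t).mul_left (σ - 1 / 2)
  refine h.congr fun ρ ↦ ?_
  rw [re_inv_sub_zero_of_RH hRH]
  ring

/-! ## The main lemma -/

set_option maxHeartbeats 800000 in
/-- **Balazard–de Roton 2008, Proposition 5 (Soundararajan's main lemma), under RH.** There is an
absolute constant `C` such that for `½ < σ ≤ 2`, `3 ≤ x ≤ t`, `t ≥ 8`,

  `log|ζ(σ+it)| ≥ Q_{x,t}(σ)/log x − (1 + x^{½−σ}/((σ−½) log x)) · F(σ+it)/log x − C`,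

where `Q_{x,t}(σ) = Σ_{n≤x} Λ(n)(log x − log n) cos(t log n) n^{−σ}/log n = Re Σ_{n≤x} Λ(n) log(x/n)/(n^{σ+it} log n)`
(`primeQ`) and `F(s) = Σ_ρ m(ρ) Re 1/(s−ρ)` (`reZeroSideSum`). (BR state it for `T ≤ t ≤ 2T`,
`2 ≤ x ≤ T`, `T` large; here `x ≥ 3` so that `log x ≥ 1`.) Proof through the Guinand–Weil explicit
formula, see the module docstring. [cite: BalazardDeRoton2008, Prop. 5] -/
theorem BR_prop5 (hRH : RiemannHypothesis) : ∃ C : ℝ, ∀ σ t x : ℝ, 1 / 2 < σ → σ ≤ 2 → 3 ≤ x → x ≤ t → 8 ≤ t →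
    primeQ x t σ / Real.log x -
        (1 + Real.exp ((1 / 2 - σ) * Real.log x) / ((σ - 1 / 2) * Real.log x)) *
          reZeroSideSum ((σ : ℂ) + t * I) / Real.log x - C ≤
      Real.log ‖riemannZeta ((σ : ℂ) + t * I)‖ := by
  obtain ⟨K, hK0, hK⟩ := re_weilArchTerm_test
  refine ⟨K + 25, fun σ t x hσ hσ2 hx hxt ht ↦ ?_⟩
  -- basic quantities
  have hx0 : 0 < x := by linarith
  have hx1 : 1 ≤ x := by linarith
  set L : ℝ := Real.log x with hL
  have hL1 : 1 ≤ L := by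
    rw [hL, ← Real.log_exp 1]
    exact Real.log_le_log (Real.exp_pos 1) (by linarith [Real.exp_one_lt_d9])
  have hL0 : 0 < L := by linarith
  have hLx : L ≤ x := by rw [hL]; exact (Real.log_le_sub_one_of_pos hx0).trans (by linarith)
  have hLt : L ≤ t := hLx.trans hxt
  have hexpL : Real.exp L = x := by rw [hL, Real.exp_log hx0]
  have ht0 : t ≠ 0 := by intro h; linarith
  have ht2 : (2 : ℝ) ≤ t := by linarith
  have hσ' : 0 < σ - 1 / 2 := by linarith
  have hlogt : 0 ≤ Real.log t := Real.log_nonneg (by linarith)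
  -- (0) continuity / integrability of the four functions of `u`
  have hzc := continuousOn_zeroSide_test hRH hσ t hL0.le
  have hqc := continuousOn_weilPolarTerm_test (σ := σ) (L := L) hL0.le ht0
  have hpc : Continuous fun u : ℝ ↦ (weilPrimeTerm (test (((u - 1 / 2 : ℝ) : ℂ) + t * I) L)).re := by
    have e : (fun u : ℝ ↦ (weilPrimeTerm (test (((u - 1 / 2 : ℝ) : ℂ) + t * I) L)).re) =
        fun u : ℝ ↦ 2 * ∑ n ∈ Finset.Icc 1 ⌊x⌋₊, (ArithmeticFunction.vonMangoldt n : ℝ) * (Real.log x - Real.log n) *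
          Real.cos (t * Real.log n) * Real.exp (-u * Real.log n) := by
      funext u; rw [hL, re_weilPrimeTerm_test hx1]
    rw [e]; fun_prop
  have hiz : IntervalIntegrable (fun u : ℝ ↦ (∑' ρ : 𝒵, (riemannZetaZeroOrder (ρ : ℂ) : ℂ) *
      weilMellin (test (((u - 1 / 2 : ℝ) : ℂ) + t * I) L) ρ).re) volume σ 2 :=
    (Complex.continuous_re.comp_continuousOn hzc).intervalIntegrable_of_Icc hσ2
  have hiq : IntervalIntegrable (fun u : ℝ ↦ (weilPolarTerm (test (((u - 1 / 2 : ℝ) : ℂ) + t * I) L)).re) volume σ 2 :=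
    (Complex.continuous_re.comp_continuousOn hqc).intervalIntegrable_of_Icc hσ2
  have hip : IntervalIntegrable (fun u : ℝ ↦ (weilPrimeTerm (test (((u - 1 / 2 : ℝ) : ℂ) + t * I) L)).re) volume σ 2 :=
    hpc.intervalIntegrable _ _
  -- (1) the explicit formula pointwise: `Re A_u = Re Z_u − Re polar_u + Re P_u`
  have hEF : ∀ u ∈ Icc σ 2, (weilArchTerm (test (((u - 1 / 2 : ℝ) : ℂ) + t * I) L)).re =
      (∑' ρ : 𝒵, (riemannZetaZeroOrder (ρ : ℂ) : ℂ) * weilMellin (test (((u - 1 / 2 : ℝ) : ℂ) + t * I) L) ρ).re -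
        (weilPolarTerm (test (((u - 1 / 2 : ℝ) : ℂ) + t * I) L)).re +
          (weilPrimeTerm (test (((u - 1 / 2 : ℝ) : ℂ) + t * I) L)).re := by
    intro u hu
    rw [explicit_formula_test hRH hσ hu.1 hu.2 hL0.le]
    unfold weilFunctional
    simp only [Complex.add_re, Complex.sub_re]
    ring
  have hac : ContinuousOn (fun u : ℝ ↦ (weilArchTerm (test (((u - 1 / 2 : ℝ) : ℂ) + t * I) L)).re) (Icc σ 2) :=
    (((Complex.continuous_re.comp_continuousOn hzc).sub (Complex.continuous_re.comp_continuousOn hqc)).add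
      hpc.continuousOn).congr hEF
  have hia : IntervalIntegrable (fun u : ℝ ↦ (weilArchTerm (test (((u - 1 / 2 : ℝ) : ℂ) + t * I) L)).re) volume σ 2 :=
    hac.intervalIntegrable_of_Icc hσ2
  -- (2) integrate: `∫A = ∫Z − ∫Q + ∫P`
  have hint : ∫ u in σ..2, (weilArchTerm (test (((u - 1 / 2 : ℝ) : ℂ) + t * I) L)).re =
      (∫ u in σ..2, (∑' ρ : 𝒵, (riemannZetaZeroOrder (ρ : ℂ) : ℂ) * weilMellin (test (((u - 1 / 2 : ℝ) : ℂ) + t * I) L) ρ).re) -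
        (∫ u in σ..2, (weilPolarTerm (test (((u - 1 / 2 : ℝ) : ℂ) + t * I) L)).re) +
          ∫ u in σ..2, (weilPrimeTerm (test (((u - 1 / 2 : ℝ) : ℂ) + t * I) L)).re := by
    rw [← intervalIntegral.integral_sub hiz hiq, ← intervalIntegral.integral_add (hiz.sub hiq) hip]
    refine intervalIntegral.integral_congr fun u hu ↦ ?_
    rw [Set.uIcc_of_le hσ2] at hu
    exact hEF u hu
  -- (3) the archimedean integral: `|∫A − (2−σ) L log t| ≤ K L (2 − σ)`
  have hA : |(∫ u in σ..2, (weilArchTerm (test (((u - 1 / 2 : ℝ) : ℂ) + t * I) L)).re) - (2 - σ) * (L * Real.log t)| ≤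
      K * L * (2 - σ) := by
    have hb := intervalIntegral.norm_integral_le_of_norm_le_const (a := σ) (b := 2) (C := K * L)
      (f := fun u : ℝ ↦ (weilArchTerm (test (((u - 1 / 2 : ℝ) : ℂ) + t * I) L)).re - L * Real.log t) ?_
    · rw [intervalIntegral.integral_sub hia intervalIntegrable_const, intervalIntegral.integral_const, smul_eq_mul,
        Real.norm_eq_abs, abs_of_nonneg (by linarith : (0 : ℝ) ≤ 2 - σ)] at hb
      exact hb
    · intro u hu
      rw [Set.uIoc_of_le hσ2] at hu
      rw [Real.norm_eq_abs]
      exact hK (u - 1 / 2) t L (by linarith [hu.1]) (by linarith [hu.2]) ht hL1 hLt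
  -- (4) the polar integral: `|∫Q| ≤ 8 (2 − σ)`
  have hQ : |∫ u in σ..2, (weilPolarTerm (test (((u - 1 / 2 : ℝ) : ℂ) + t * I) L)).re| ≤ 8 * (2 - σ) := by
    have hb := intervalIntegral.norm_integral_le_of_norm_le_const (a := σ) (b := 2) (C := 8)
      (f := fun u : ℝ ↦ (weilPolarTerm (test (((u - 1 / 2 : ℝ) : ℂ) + t * I) L)).re) ?_
    · rw [Real.norm_eq_abs, abs_of_nonneg (by linarith : (0 : ℝ) ≤ 2 - σ)] at hb
      exact hb
    · intro u hu
      rw [Set.uIoc_of_le hσ2] at hu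
      rw [Real.norm_eq_abs]
      refine (Complex.abs_re_le_norm _).trans ?_
      exact norm_weilPolarTerm_test_le hL0.le hLt (by rw [hexpL]; exact hxt) ht (by linarith [hu.1])
  -- (5) the prime integral
  have hP : ∫ u in σ..2, (weilPrimeTerm (test (((u - 1 / 2 : ℝ) : ℂ) + t * I) L)).re =
      2 * (primeQ x t σ - primeQ x t 2) := by
    rw [hL]; exact integral_re_weilPrimeTerm_test hx1 t σ
  have hQ2 := abs_primeQ_two_le hx1 t
  rw [← hL] at hQ2
  -- (6) the zero side: `∫Z = Σ m I_ρ = SE + 2F(s') − 2F(s) + 2L ∫F`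
  have hZ := integral_re_zeroSide_test hRH hσ hσ2 t hL0.le
  -- per-zero decomposition
  set R : 𝒵 → ℝ := fun ρ ↦ ((1 / (((2 : ℂ) + t * I) - ρ)).re - (1 / (((σ : ℂ) + t * I) - ρ)).re) +
    ((1 / (((2 : ℂ) + t * I) - conj (ρ : ℂ))).re - (1 / (((σ : ℂ) + t * I) - conj (ρ : ℂ))).re) with hR
  set Λρ : 𝒵 → ℝ := fun ρ ↦ (Real.log ‖((2 : ℂ) + t * I) - ρ‖ - Real.log ‖((σ : ℂ) + t * I) - ρ‖) +
    (Real.log ‖((2 : ℂ) + t * I) - conj (ρ : ℂ)‖ - Real.log ‖((σ : ℂ) + t * I) - conj (ρ : ℂ)‖) with hΛρ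
  set Iρ : 𝒵 → ℝ := fun ρ ↦ ∫ u in σ..2, (weilMellin (test (((u - 1 / 2 : ℝ) : ℂ) + t * I) L) ρ).re with hIρ
  set B : 𝒵 → ℝ := fun ρ ↦ Real.exp ((1 / 2 - σ) * L) / L *
    (1 / ((σ - 1 / 2) ^ 2 + ((ρ : ℂ).im - t) ^ 2) + 1 / ((σ - 1 / 2) ^ 2 + ((ρ : ℂ).im + t) ^ 2)) with hB
  have hdec : ∀ ρ : 𝒵, |Iρ ρ - R ρ - L * Λρ ρ| ≤ B ρ := by
    intro ρ
    obtain ⟨E, hE, hI⟩ := integral_re_weilMellin_test_zero hRH ρ hσ hσ2 t hL0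
    rw [one_sub_eq_conj_of_RH hRH ρ] at hE hI
    have e : Iρ ρ - R ρ - L * Λρ ρ = E := by
      simp only [hIρ, hR, hΛρ]; rw [hI]; ring
    rw [e]
    refine hE.trans (le_of_eq ?_)
    rw [hB, norm_sq_sub_zero_of_RH hRH, norm_sq_sub_conj_zero_of_RH hRH]
  -- summable families
  have hm0 : ∀ ρ : 𝒵, 0 ≤ (riemannZetaZeroOrder (ρ : ℂ) : ℝ) := zeroOrder_nonneg
  have hsR1 : Summable fun ρ : 𝒵 ↦ (riemannZetaZeroOrder (ρ : ℂ) : ℝ) * (1 / (((σ : ℂ) + t * I) - ρ)).re := summable_zeroOrder_mul_re_inv hRH hσ t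
  have hsR2 : Summable fun ρ : 𝒵 ↦ (riemannZetaZeroOrder (ρ : ℂ) : ℝ) * (1 / (((2 : ℂ) + t * I) - ρ)).re := by
    have := summable_zeroOrder_mul_re_inv hRH (σ := 2) (by norm_num) t
    push_cast at this; exact this
  have hsR3 : Summable fun ρ : 𝒵 ↦ (riemannZetaZeroOrder (ρ : ℂ) : ℝ) * (1 / (((σ : ℂ) + t * I) - conj (ρ : ℂ))).re :=
    ((summable_conj_iff (E := ℝ) (fun w ↦ (1 / (((σ : ℂ) + t * I) - w)).re)).2
      (by simpa only [smul_eq_mul] using hsR1)).congr fun ρ ↦ by simp only [smul_eq_mul]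
  have hsR4 : Summable fun ρ : 𝒵 ↦ (riemannZetaZeroOrder (ρ : ℂ) : ℝ) * (1 / (((2 : ℂ) + t * I) - conj (ρ : ℂ))).re :=
    ((summable_conj_iff (E := ℝ) (fun w ↦ (1 / (((2 : ℂ) + t * I) - w)).re)).2
      (by simpa only [smul_eq_mul] using hsR2)).congr fun ρ ↦ by simp only [smul_eq_mul]
  have hsΛ1 : Summable fun ρ : 𝒵 ↦ (riemannZetaZeroOrder (ρ : ℂ) : ℝ) * (Real.log ‖((2 : ℂ) + t * I) - ρ‖ - Real.log ‖((σ : ℂ) + t * I) - ρ‖) :=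
    summable_zeroOrder_mul_log_norm_sub hRH hσ hσ2 t
  have hsΛ2 : Summable fun ρ : 𝒵 ↦ (riemannZetaZeroOrder (ρ : ℂ) : ℝ) * (Real.log ‖((2 : ℂ) + t * I) - conj (ρ : ℂ)‖ -
      Real.log ‖((σ : ℂ) + t * I) - conj (ρ : ℂ)‖) :=
    ((summable_conj_iff (E := ℝ) (fun w ↦ Real.log ‖((2 : ℂ) + t * I) - w‖ - Real.log ‖((σ : ℂ) + t * I) - w‖)).2
      (by simpa only [smul_eq_mul] using hsΛ1)).congr fun ρ ↦ by simp only [smul_eq_mul]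
  have hsB : Summable fun ρ : 𝒵 ↦ (riemannZetaZeroOrder (ρ : ℂ) : ℝ) * B ρ := by
    have := (summable_zeroOrder_mul_two_inv hσ t).mul_left (Real.exp ((1 / 2 - σ) * L) / L)
    refine this.congr fun ρ ↦ ?_
    simp only [hB]; ring
  have hsRm : Summable fun ρ : 𝒵 ↦ (riemannZetaZeroOrder (ρ : ℂ) : ℝ) * R ρ := by
    refine (((hsR2.sub hsR1).add (hsR4.sub hsR3))).congr fun ρ ↦ ?_
    simp only [hR]; ring
  have hsΛm : Summable fun ρ : 𝒵 ↦ (riemannZetaZeroOrder (ρ : ℂ) : ℝ) * Λρ ρ := by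
    refine ((hsΛ1.add hsΛ2)).congr fun ρ ↦ ?_
    simp only [hΛρ]; ring
  have hsE : Summable fun ρ : 𝒵 ↦ (riemannZetaZeroOrder (ρ : ℂ) : ℝ) * (Iρ ρ - R ρ - L * Λρ ρ) := by
    refine Summable.of_norm_bounded hsB fun ρ ↦ ?_
    rw [Real.norm_eq_abs, abs_mul, abs_of_nonneg (hm0 ρ)]
    exact mul_le_mul_of_nonneg_left (hdec ρ) (hm0 ρ)
  -- the values of the sums
  have hF : reZeroSideSum ((σ : ℂ) + t * I) = ∑' ρ : 𝒵, (riemannZetaZeroOrder (ρ : ℂ) : ℝ) * (1 / (((σ : ℂ) + t * I) - ρ)).re := by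
    rw [reZeroSideSum_def]; rfl
  have hF2 : reZeroSideSum ((2 : ℂ) + t * I) = ∑' ρ : 𝒵, (riemannZetaZeroOrder (ρ : ℂ) : ℝ) * (1 / (((2 : ℂ) + t * I) - ρ)).re := by
    rw [reZeroSideSum_def]; rfl
  have hF3 : ∑' ρ : 𝒵, (riemannZetaZeroOrder (ρ : ℂ) : ℝ) * (1 / (((σ : ℂ) + t * I) - conj (ρ : ℂ))).re = reZeroSideSum ((σ : ℂ) + t * I) := by
    rw [hF]; exact tsum_zeroOrder_mul_conj_real (fun w ↦ (1 / (((σ : ℂ) + t * I) - w)).re)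
  have hF4 : ∑' ρ : 𝒵, (riemannZetaZeroOrder (ρ : ℂ) : ℝ) * (1 / (((2 : ℂ) + t * I) - conj (ρ : ℂ))).re = reZeroSideSum ((2 : ℂ) + t * I) := by
    rw [hF2]; exact tsum_zeroOrder_mul_conj_real (fun w ↦ (1 / (((2 : ℂ) + t * I) - w)).re)
  have hΛint := integral_reZeroSideSum hRH hσ hσ2 t
  have hΛ2 : ∑' ρ : 𝒵, (riemannZetaZeroOrder (ρ : ℂ) : ℝ) * (Real.log ‖((2 : ℂ) + t * I) - conj (ρ : ℂ)‖ - Real.log ‖((σ : ℂ) + t * I) - conj (ρ : ℂ)‖) =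
      ∫ u in σ..2, reZeroSideSum ((u : ℂ) + t * I) := by
    rw [hΛint]
    exact tsum_zeroOrder_mul_conj_real (fun w ↦ Real.log ‖((2 : ℂ) + t * I) - w‖ - Real.log ‖((σ : ℂ) + t * I) - w‖)
  have hRsum : ∑' ρ : 𝒵, (riemannZetaZeroOrder (ρ : ℂ) : ℝ) * R ρ = 2 * reZeroSideSum ((2 : ℂ) + t * I) - 2 * reZeroSideSum ((σ : ℂ) + t * I) := by
    have e : (fun ρ : 𝒵 ↦ (riemannZetaZeroOrder (ρ : ℂ) : ℝ) * R ρ) = fun ρ : 𝒵 ↦ ((riemannZetaZeroOrder (ρ : ℂ) : ℝ) * (1 / (((2 : ℂ) + t * I) - ρ)).re - (riemannZetaZeroOrder (ρ : ℂ) : ℝ) * (1 / (((σ : ℂ) + t * I) - ρ)).re) +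
        ((riemannZetaZeroOrder (ρ : ℂ) : ℝ) * (1 / (((2 : ℂ) + t * I) - conj (ρ : ℂ))).re - (riemannZetaZeroOrder (ρ : ℂ) : ℝ) * (1 / (((σ : ℂ) + t * I) - conj (ρ : ℂ))).re) := by
      funext ρ; simp only [hR]; ring
    rw [e, (hsR2.sub hsR1).tsum_add (hsR4.sub hsR3), hsR2.tsum_sub hsR1, hsR4.tsum_sub hsR3, ← hF, ← hF2, hF3, hF4]
    ring
  have hΛsum : ∑' ρ : 𝒵, (riemannZetaZeroOrder (ρ : ℂ) : ℝ) * Λρ ρ = 2 * ∫ u in σ..2, reZeroSideSum ((u : ℂ) + t * I) := by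
    have e : (fun ρ : 𝒵 ↦ (riemannZetaZeroOrder (ρ : ℂ) : ℝ) * Λρ ρ) = fun ρ : 𝒵 ↦ (riemannZetaZeroOrder (ρ : ℂ) : ℝ) * (Real.log ‖((2 : ℂ) + t * I) - ρ‖ - Real.log ‖((σ : ℂ) + t * I) - ρ‖) +
        (riemannZetaZeroOrder (ρ : ℂ) : ℝ) * (Real.log ‖((2 : ℂ) + t * I) - conj (ρ : ℂ)‖ - Real.log ‖((σ : ℂ) + t * I) - conj (ρ : ℂ)‖) := by
      funext ρ; simp only [hΛρ]; ring
    rw [e, hsΛ1.tsum_add hsΛ2, hΛ2, ← hΛint]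
    ring
  have hBsum : ∑' ρ : 𝒵, (riemannZetaZeroOrder (ρ : ℂ) : ℝ) * B ρ =
      Real.exp ((1 / 2 - σ) * L) / L * (2 * (reZeroSideSum ((σ : ℂ) + t * I) / (σ - 1 / 2))) := by
    -- `Σ m/D₁ = F(s)/(σ−½)` and `Σ m/D₂ = Σ m/D₁` (reindex by conjugation)
    have hD1 : ∑' ρ : 𝒵, (riemannZetaZeroOrder (ρ : ℂ) : ℝ) / ((σ - 1 / 2) ^ 2 + ((ρ : ℂ).im - t) ^ 2) = reZeroSideSum ((σ : ℂ) + t * I) / (σ - 1 / 2) := by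
      rw [reZeroSideSum_eq_of_RH hRH, mul_div_cancel_left₀ _ hσ'.ne']
    have hD2 : ∑' ρ : 𝒵, (riemannZetaZeroOrder (ρ : ℂ) : ℝ) / ((σ - 1 / 2) ^ 2 + ((ρ : ℂ).im + t) ^ 2) =
        ∑' ρ : 𝒵, (riemannZetaZeroOrder (ρ : ℂ) : ℝ) / ((σ - 1 / 2) ^ 2 + ((ρ : ℂ).im - t) ^ 2) := by
      have := tsum_zeroOrder_mul_conj_real (fun w ↦ 1 / ((σ - 1 / 2) ^ 2 + (w.im - t) ^ 2))
      simp only [Complex.conj_im] at this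
      rw [← tsum_congr (fun ρ ↦ ?_), this]
      · exact tsum_congr fun ρ ↦ by ring
      · rw [show (-(ρ : ℂ).im - t) ^ 2 = ((ρ : ℂ).im + t) ^ 2 by ring]
        ring
    have e : (fun ρ : 𝒵 ↦ (riemannZetaZeroOrder (ρ : ℂ) : ℝ) * B ρ) = fun ρ : 𝒵 ↦ Real.exp ((1 / 2 - σ) * L) / L *
        ((riemannZetaZeroOrder (ρ : ℂ) : ℝ) / ((σ - 1 / 2) ^ 2 + ((ρ : ℂ).im - t) ^ 2) + (riemannZetaZeroOrder (ρ : ℂ) : ℝ) / ((σ - 1 / 2) ^ 2 + ((ρ : ℂ).im + t) ^ 2)) := by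
      funext ρ; simp only [hB]; ring
    rw [e, tsum_mul_left, (summable_zeroOrder_div_dist_sq hσ t).tsum_add
      ((summable_zeroOrder_div_dist_sq hσ (-t)).congr fun ρ ↦ by simp only [sub_neg_eq_add]), hD2, hD1]
    ring
  -- `∫Z = Σ m Iρ = Σ mE + Σ mR + L Σ mΛ`
  have hZsum : (∫ u in σ..2, (∑' ρ : 𝒵, (riemannZetaZeroOrder (ρ : ℂ) : ℂ) *
      weilMellin (test (((u - 1 / 2 : ℝ) : ℂ) + t * I) L) ρ).re) =
      (∑' ρ : 𝒵, (riemannZetaZeroOrder (ρ : ℂ) : ℝ) * (Iρ ρ - R ρ - L * Λρ ρ)) +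
        (2 * reZeroSideSum ((2 : ℂ) + t * I) - 2 * reZeroSideSum ((σ : ℂ) + t * I)) +
          L * (2 * ∫ u in σ..2, reZeroSideSum ((u : ℂ) + t * I)) := by
    rw [hZ, ← hRsum, ← hΛsum, ← tsum_mul_left, ← hsE.tsum_add hsRm, ← (hsE.add hsRm).tsum_add (hsΛm.mul_left L)]
    refine tsum_congr fun ρ ↦ ?_
    simp only [hIρ]
    ring
  have hEabs : |∑' ρ : 𝒵, (riemannZetaZeroOrder (ρ : ℂ) : ℝ) * (Iρ ρ - R ρ - L * Λρ ρ)| ≤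
      Real.exp ((1 / 2 - σ) * L) / L * (2 * (reZeroSideSum ((σ : ℂ) + t * I) / (σ - 1 / 2))) := by
    rw [← hBsum, ← Real.norm_eq_abs]
    refine (norm_tsum_le_tsum_norm hsE.norm).trans ?_
    refine Summable.tsum_le_tsum (fun ρ ↦ ?_) hsE.norm hsB
    rw [Real.norm_eq_abs, abs_mul, abs_of_nonneg (hm0 ρ)]
    exact mul_le_mul_of_nonneg_left (hdec ρ) (hm0 ρ)
  -- (7) `∫F` versus `log|ζ|`, `F(s') ≥ 0`, `log|ζ(s')| ≥ −log 3`
  have hFint := abs_integral_reZeroSideSum_sub_le hRH hσ hσ2 ht2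
  have hF2nn : 0 ≤ reZeroSideSum ((2 : ℂ) + t * I) := by
    have := reZeroSideSum_nonneg_of_RH hRH (σ := 2) (by norm_num) t
    push_cast at this; exact this
  have hFnn : 0 ≤ reZeroSideSum ((σ : ℂ) + t * I) := reZeroSideSum_nonneg_of_RH hRH hσ t
  have hζ2 : -2 ≤ Real.log ‖riemannZeta ((2 : ℂ) + t * I)‖ := by
    have h13 := one_third_le_norm_riemannZeta_two_add t
    have : Real.log (1 / 3) ≤ Real.log ‖riemannZeta ((2 : ℂ) + t * I)‖ := Real.log_le_log (by norm_num) h13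
    have h3 : Real.log (1 / 3) = -Real.log 3 := by rw [one_div, Real.log_inv]
    have : Real.log 3 ≤ 2 := by
      have := Real.log_le_sub_one_of_pos (show (0 : ℝ) < 3 by norm_num); linarith
    linarith
  -- (8) assemble
  set Z : ℝ := ∫ u in σ..2, (∑' ρ : 𝒵, (riemannZetaZeroOrder (ρ : ℂ) : ℂ) *
    weilMellin (test (((u - 1 / 2 : ℝ) : ℂ) + t * I) L) ρ).re with hZdef
  set A : ℝ := ∫ u in σ..2, (weilArchTerm (test (((u - 1 / 2 : ℝ) : ℂ) + t * I) L)).re with hAdef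
  set Q : ℝ := ∫ u in σ..2, (weilPolarTerm (test (((u - 1 / 2 : ℝ) : ℂ) + t * I) L)).re with hQdef
  set P : ℝ := ∫ u in σ..2, (weilPrimeTerm (test (((u - 1 / 2 : ℝ) : ℂ) + t * I) L)).re with hPdef
  set IF : ℝ := ∫ u in σ..2, reZeroSideSum ((u : ℂ) + t * I) with hIFdef
  set SE : ℝ := ∑' ρ : 𝒵, (riemannZetaZeroOrder (ρ : ℂ) : ℝ) * (Iρ ρ - R ρ - L * Λρ ρ) with hSEdef
  set Fs : ℝ := reZeroSideSum ((σ : ℂ) + t * I) with hFs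
  set Fs' : ℝ := reZeroSideSum ((2 : ℂ) + t * I) with hFs'
  set ℓ : ℝ := Real.log ‖riemannZeta ((σ : ℂ) + t * I)‖ with hℓ
  set ℓ' : ℝ := Real.log ‖riemannZeta ((2 : ℂ) + t * I)‖ with hℓ'
  set EX : ℝ := Real.exp ((1 / 2 - σ) * L) with hEX
  have hEX0 : 0 ≤ EX := (Real.exp_pos _).le
  -- collect the linear facts
  have f1 : A = Z - Q + P := hint
  have f2 : Z = SE + (2 * Fs' - 2 * Fs) + L * (2 * IF) := hZsum
  have f3 := abs_le.1 hFint    -- |IF − (ℓ' − ℓ) − (2−σ) log t/2| ≤ 4(2−σ)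
  have f4 := abs_le.1 hA       -- |A − (2−σ) L log t| ≤ K L (2−σ)
  have f5 := abs_le.1 hQ       -- |Q| ≤ 8(2−σ)
  have f6 : P = 2 * (primeQ x t σ - primeQ x t 2) := hP
  have f7 := abs_le.1 hQ2      -- |primeQ 2| ≤ 2L
  have f8 := abs_le.1 hEabs    -- |SE| ≤ EX/L · (2 Fs/(σ−½))
  -- `2L ℓ = 2L ℓ' + (2−σ) L log t + 2L e + SE + 2Fs' − 2Fs − Z`, from f2 and f3
  -- lower bound for `2 L ℓ`
  have key : 2 * primeQ x t σ - 2 * Fs - EX / L * (2 * (Fs / (σ - 1 / 2))) - L * (2 * 2 + 16 + 2 * K) - 16 - 8 * L ≤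
      2 * L * ℓ := by
    have h2σ : 0 ≤ 2 - σ := by linarith
    -- multiply f3 by `2L ≥ 0`
    have g3 := mul_le_mul_of_nonneg_left f3.1 (by positivity : (0 : ℝ) ≤ 2 * L)
    have g3' := mul_le_mul_of_nonneg_left f3.2 (by positivity : (0 : ℝ) ≤ 2 * L)
    -- `σ K L ≥ 0`, `L ℓ' ≥ −2L`, `σ L ≥ 0`
    have gK : 0 ≤ σ * (K * L) := by positivity
    have gℓ' : -2 * L ≤ L * ℓ' := by nlinarith [hζ2, hL0]
    have gσL : 0 ≤ σ * L := by positivity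
    linarith [f4.1, f4.2, f5.1, f5.2, f7.1, f7.2, f8.1, f8.2, hF2nn, hFnn, hL1, g3, g3', gK, gℓ', gσL]
  -- divide by `2L`
  have hgoal : primeQ x t σ / L - (1 + EX / ((σ - 1 / 2) * L)) * Fs / L - (K + 25) ≤ ℓ := by
    have e1 : primeQ x t σ / L - (1 + EX / ((σ - 1 / 2) * L)) * Fs / L - (K + 25) =
        (2 * primeQ x t σ - 2 * Fs - EX / L * (2 * (Fs / (σ - 1 / 2))) - 2 * L * (K + 25)) / (2 * L) := by
      field_simp
      ring
    rw [e1, div_le_iff₀ (by positivity)]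
    have gKL : 0 ≤ K * L := by positivity
    linarith [key, hL1]
  exact hgoal

end SoundTest

end Literature.NumberTheory.LFunctions
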